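/-
Copyright (c) 2026. All rights reserved.
Released under Apache 2.0 license as described in the file LICENSE.
Authors: abc-iut cell, prover seat abc-iut-f-167 (block F, gen 5).
-/
import Literature.IUT.LogVolume.UnitLogRamificationCriterion
import HarnessLib

/-!
# Depth of the log-unit lattice along a wildly ramified extension: `max‖log_p(𝒪_{K'}^×)‖ ≥ pᵗ·max‖log_p(𝒪_K^×)‖`

Proof-only companion (theorems, no definitions) of the cell's unit-logarithm files (`LocalUnitLog.lean`,
`LogSeriesDominantTerm.lean`, `UnitLogRamificationCriterion.lean`), written for the DEPTH hypothesis of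
`TensorPacketSemilinearTransport.lean` (item (X) of the G1-Θ memo beyond saturation: «for every
`z ∈ log_p(R_i^×)` some `z' ∈ log_p(R'_i^×)` has `‖z'‖ ≥ p^{T_i}·‖z‖`»).  For a mixed-characteristic local
field `K` (normed `ℚ_p`-algebra, ultrametric, proper) with absolute ramification index `e`, write
`h(a) = pᵃ − e·a` (the exponents of the prime-power terms of `L(1 − ϖ)`), `a₀` for its turning point
(`pᵃ(p−1) < e` for `a < a₀`, `e ≤ p^{a₀}(p−1)`) and `N₀ = h(a₀) = min h`.  PROVED:

* `norm_le_zpow_of_mem_logUnits` — **`‖z‖ ≤ ‖ϖ‖^{N₀}` for every `z ∈ log_p(𝒪_K^×)`** (every term of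
  `L(uᵐ)`, `uᵐ` principal, `p ∤ m`, has exponent `s·n − e·v_p(n) ≥ h(a) ≥ N₀`);
* `norm_logSeries_one_sub_unif_pow` — for a second field `K'` with `e(K') = e·c·pᵗ` (`c ≥ 1`) and `K`
  TIE-FREE (`e < p^{a₀}(p−1)`, i.e. `e/(p−1)` is not a power of `p`):
  **`‖L(1 − ϖ'ᶜ)‖ = ‖ϖ'‖^{c·p^{a₀+t} − e'·(a₀+t)}`** EXACTLY (the exponents of `L(1 − ϖ'ᶜ)` are
  `c·(n − e pᵗ v_p(n))`, with turning point `a₀ + t` and a strict turning inequality, so the term of index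
  `p^{a₀+t}` dominates);
* **`exists_mem_logUnits_pow_mul_norm_le`** — hence, as real numbers `‖ϖ‖ = p^{−1/e}`, `‖ϖ'‖ = p^{−1/e'}`:
  **for every `z ∈ log_p(𝒪_K^×)` the log-unit `z' := log_p(1 − ϖ'ᶜ) ∈ log_p(𝒪_{K'}^×)` has
  `‖z'‖ = pᵗ·‖ϖ‖^{N₀} ≥ pᵗ·‖z‖`** — the depth inequality with `T = t` for ANY pair of fields whose
  ramification indices satisfy `e(K') = e(K)·c·pᵗ` and `e(K)/(p−1) ∉ p^ℕ` (no embedding `K → K'` is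
  needed; when `K ⊆ K'`, `c·pᵗ = e(K'/K)` and `t = v_p(e(K'/K))` is the wild part).

The tie case `e(K) = pᵃ(p−1)` (e.g. `K ⊇ ℚ_p(ζ_p)`-like fields) is NOT treated: there the term of index
`p^{a₀+t}` ties with its successor and `‖L(1 − ϖ'ᶜ)‖` depends on the residue of `ϖ'^{e'}/p`.
Classical (Neukirch, *Algebraic Number Theory* II (5.5)); nothing here is disputed mathematics; no IUT statement
is asserted; nothing bears on [IUTchIII] Cor. 3.12.
-/

noncomputable section

open Metric Set

namespace Literature.IUT.LogVolume

namespace RamificationCriterion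

open Literature.NumberTheory.GaloisRepresentations.Ultrametric

variable (p : ℕ) [hp : Fact p.Prime]
variable {K : Type*} [NontriviallyNormedField K] [instK : NormedAlgebra ℚ_[p] K] [IsUltrametricDist K]
  [ProperSpace K]
variable {K' : Type*} [NontriviallyNormedField K'] [instK' : NormedAlgebra ℚ_[p] K'] [IsUltrametricDist K']
  [ProperSpace K']

/-! ### §1. The universal upper bound `‖log_p u‖ ≤ ‖ϖ‖^{N₀}` -/

/-- **Every log-unit has norm `≤ ‖ϖ‖^{h(a₀)}`**, `h(a) = pᵃ − e·a`, `a₀` the turning point: for a unit `u`,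
`log_p u = m⁻¹·L(uᵐ)` with `uᵐ` principal, `p ∤ m`, and every term of `L(y)` (`‖1 − y‖ = ‖ϖ‖ˢ`, `s ≥ 1`)
has exponent `s·n − e·v_p(n) ≥ s·pᵃ − e·a ≥ pᵃ − e·a ≥ h(a₀)`. [cite: NeukirchANT1999, Ch. II (5.5)] -/
theorem norm_le_zpow_of_mem_logUnits {ϖ : Kˣ} (hϖ : IsUniformizer ϖ) {a₀ : ℕ}
    (hlo : ∀ a < a₀, (1 : ℤ) * (p : ℤ) ^ a * ((p : ℤ) - 1) < absRamificationIdx p K)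
    (hhi : (absRamificationIdx p K : ℤ) ≤ 1 * (p : ℤ) ^ a₀ * ((p : ℤ) - 1))
    {z : K} (hz : z ∈ logUnits K) :
    ‖z‖ ≤ ‖(ϖ : K)‖ ^ ((1 : ℤ) * (p : ℤ) ^ a₀ - (absRamificationIdx p K : ℤ) * (a₀ : ℤ)) := by
  classical
  obtain ⟨u, hu, rfl⟩ := (mem_logUnits_iff).mp hz
  have hρ0 : 0 < ‖(ϖ : K)‖ := norm_units_pos ϖ
  set e : ℕ := absRamificationIdx p K with he_def
  have hP : (2 : ℤ) ≤ (p : ℤ) := by exact_mod_cast hp.out.two_le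
  have hmin := exponent_min (a₀ := a₀) (le_refl (1 : ℤ)) hP hlo hhi
  obtain ⟨m, hm0, hmp, hmP⟩ := exists_pow_isPrincipal_not_dvd (p := p) hu
  rw [unitLog_eq_inv_mul_logSeries p hm0 hmP, norm_mul, norm_inv, norm_natCast_eq_one_of_not_dvd p hmp,
    inv_one, one_mul]
  set y : K := u ^ m with hy_def
  by_cases hx : 1 - y = 0
  · have : y = 1 := (sub_eq_zero.mp hx).symm
    rw [this, logSeries_one, norm_zero]
    exact (zpow_pos hρ0 _).le
  obtain ⟨s, hs⟩ := hϖ.2 (Units.mk0 (1 - y) hx)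
  rw [Units.val_mk0] at hs
  have hs1 : 1 ≤ s := by
    have h1 : ‖(ϖ : K)‖ ^ s < 1 := hs ▸ hmP
    have := (zpow_lt_one_iff_right_of_lt_one₀ hρ0 hϖ.1).mp h1
    omega
  refine norm_logSeries_le (zpow_pos hρ0 _).le fun n ↦ ?_
  rw [norm_logTerm_eq_zpow p hϖ hs n]
  refine zpow_le_zpow_right_of_le_one₀ hρ0 hϖ.1.le ?_
  obtain ⟨a, ha, -⟩ := exists_exponent_le_index (p := p) hs1 e (Nat.succ_ne_zero n)
  have hpa : (0 : ℤ) ≤ (p : ℤ) ^ a := by positivity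
  have h1 : (1 : ℤ) * (p : ℤ) ^ a - (e : ℤ) * (a : ℤ) ≤ s * (p : ℤ) ^ a - (e : ℤ) * (a : ℤ) := by nlinarith
  exact ((hmin a).trans h1).trans ha

/-- **Turning point**: there is `a₀` with `pᵃ(p−1) < e` for `a < a₀` and `e ≤ p^{a₀}(p−1)`.
[cite: NeukirchANT1999, Ch. II (5.5)] -/
theorem exists_turning (e : ℕ) :
    ∃ a₀ : ℕ, (∀ a < a₀, (1 : ℤ) * (p : ℤ) ^ a * ((p : ℤ) - 1) < e) ∧
      (e : ℤ) ≤ 1 * (p : ℤ) ^ a₀ * ((p : ℤ) - 1) := by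
  classical
  have hP : (2 : ℤ) ≤ (p : ℤ) := by exact_mod_cast hp.out.two_le
  have hex : ∃ a : ℕ, (e : ℤ) ≤ 1 * (p : ℤ) ^ a * ((p : ℤ) - 1) := exists_le_increment (le_refl _) hP e
  exact ⟨Nat.find hex, fun a ha ↦ lt_of_not_ge (Nat.find_min hex ha), Nat.find_spec hex⟩

/-! ### §2. The dominant term of `L(1 − ϖ'ᶜ)` when `e(K') = e·c·pᵗ` and `e` is tie-free -/

/-- **`‖L(1 − ϖ'ᶜ)‖ = ‖ϖ'‖^{c·p^{a₀+t} − e'·(a₀+t)}`** for `e' = e(K') = e·c·pᵗ`, `c ≥ 1`, and `a₀` a STRICT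
turning point of `h(a) = pᵃ − e·a` (`pᵃ(p−1) < e` for `a < a₀`, `e < p^{a₀}(p−1)`): the exponents of
`L(1 − ϖ'ᶜ)` are `c·n − e'·v_p(n)`, whose prime-power values `c·pᵃ − e'·a` have the strict turning point
`a₀ + t`, so the term of index `p^{a₀+t}` strictly dominates. [cite: NeukirchANT1999, Ch. II (5.5)] -/
theorem norm_logSeries_one_sub_unif_pow {ϖ' : K'ˣ} (hϖ' : IsUniformizer ϖ') {e c t a₀ : ℕ} (hc : c ≠ 0)
    (he1 : 1 ≤ e) (he' : absRamificationIdx p K' = e * (c * p ^ t))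
    (hlo : ∀ a < a₀, (1 : ℤ) * (p : ℤ) ^ a * ((p : ℤ) - 1) < e)
    (hhi : (e : ℤ) < 1 * (p : ℤ) ^ a₀ * ((p : ℤ) - 1)) :
    ‖logSeries (1 - (ϖ' : K') ^ c)‖ =
      ‖(ϖ' : K')‖ ^ ((c : ℤ) * (p : ℤ) ^ (a₀ + t) - (absRamificationIdx p K' : ℤ) * ((a₀ + t : ℕ) : ℤ)) := by
  classical
  have hρ0 : 0 < ‖(ϖ' : K')‖ := norm_units_pos ϖ'
  set e' : ℕ := absRamificationIdx p K' with he'_def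
  have hP : (2 : ℤ) ≤ (p : ℤ) := by exact_mod_cast hp.out.two_le
  have hc1 : (1 : ℤ) ≤ (c : ℤ) := by exact_mod_cast Nat.one_le_iff_ne_zero.mpr hc
  have hpt : (1 : ℤ) ≤ (p : ℤ) ^ t := by exact_mod_cast Nat.one_le_pow _ _ hp.out.pos
  -- the principal unit `y = 1 − ϖ'^c`, `‖1 − y‖ = ‖ϖ'‖^c`
  set y : K' := 1 - (ϖ' : K') ^ c with hy_def
  have hy : ‖1 - y‖ = ‖(ϖ' : K')‖ ^ (c : ℤ) := by
    rw [hy_def, sub_sub_cancel, norm_pow, zpow_natCast]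
  have hyP : IsPrincipal y := by
    rw [isPrincipal_iff, hy, zpow_natCast]
    exact pow_lt_one₀ (norm_nonneg _) hϖ'.1 hc
  -- the turning point of `c·pᵃ − e'·a` is `a₀ + t`, strictly
  have he'Z : (e' : ℤ) = (e : ℤ) * ((c : ℤ) * (p : ℤ) ^ t) := by exact_mod_cast he'
  have hlo' : ∀ a < a₀ + t, (c : ℤ) * (p : ℤ) ^ a * ((p : ℤ) - 1) < e' := by
    intro a ha
    rw [he'Z]
    rcases lt_or_ge a t with hat | hat
    · -- `c p^a (p-1) < c p^{a+1} ≤ c p^t ≤ e c p^t`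
      have h1 : (p : ℤ) ^ a * ((p : ℤ) - 1) < (p : ℤ) ^ (a + 1) := by
        rw [pow_succ]; nlinarith [pow_pos (show (0 : ℤ) < p by linarith) a]
      have h2 : (p : ℤ) ^ (a + 1) ≤ (p : ℤ) ^ t := pow_le_pow_right₀ (by linarith) (by omega)
      have he1Z : (1 : ℤ) ≤ (e : ℤ) := by exact_mod_cast he1
      have h4 : (c : ℤ) * ((p : ℤ) ^ a * ((p : ℤ) - 1)) < (c : ℤ) * (p : ℤ) ^ t :=
        mul_lt_mul_of_pos_left (h1.trans_le h2) (by linarith)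
      have h5 : (c : ℤ) * (p : ℤ) ^ t ≤ (e : ℤ) * ((c : ℤ) * (p : ℤ) ^ t) :=
        le_mul_of_one_le_left (by positivity) he1Z
      have h6 : (c : ℤ) * (p : ℤ) ^ a * ((p : ℤ) - 1) = (c : ℤ) * ((p : ℤ) ^ a * ((p : ℤ) - 1)) := by ring
      rw [h6]
      exact h4.trans_le h5
    · obtain ⟨a', rfl⟩ := Nat.exists_eq_add_of_le hat
      have h := hlo a' (by omega)
      have h0 : (0 : ℤ) < (c : ℤ) * (p : ℤ) ^ t := by positivity
      have : (c : ℤ) * (p : ℤ) ^ (t + a') * ((p : ℤ) - 1) =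
          ((c : ℤ) * (p : ℤ) ^ t) * (1 * (p : ℤ) ^ a' * ((p : ℤ) - 1)) := by ring
      rw [this]
      nlinarith
  have hhi' : (e' : ℤ) < (c : ℤ) * (p : ℤ) ^ (a₀ + t) * ((p : ℤ) - 1) := by
    rw [he'Z]
    have h0 : (0 : ℤ) < (c : ℤ) * (p : ℤ) ^ t := by positivity
    have : (c : ℤ) * (p : ℤ) ^ (a₀ + t) * ((p : ℤ) - 1) =
        ((c : ℤ) * (p : ℤ) ^ t) * (1 * (p : ℤ) ^ a₀ * ((p : ℤ) - 1)) := by ring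
    rw [this]
    nlinarith
  have hstrict : ∀ a : ℕ, a ≠ a₀ + t →
      (c : ℤ) * (p : ℤ) ^ (a₀ + t) - e' * ((a₀ + t : ℕ) : ℤ) + 1 ≤ (c : ℤ) * (p : ℤ) ^ a - e' * (a : ℤ) :=
    fun a ha ↦ exponent_min_strict (a₀ := a₀ + t) hc1 hP hlo' hhi' ha
  -- the dominant index `n₀ + 1 = p^{a₀ + t}`
  obtain ⟨n₀, hn₀1⟩ : ∃ n₀ : ℕ, n₀ + 1 = p ^ (a₀ + t) :=
    ⟨p ^ (a₀ + t) - 1, Nat.sub_add_cancel (Nat.one_le_pow _ _ hp.out.pos)⟩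
  have hN₀ : (c : ℤ) * ((n₀ + 1 : ℕ) : ℤ) - (e' : ℤ) * (padicValNat p (n₀ + 1) : ℤ)
      = (c : ℤ) * (p : ℤ) ^ (a₀ + t) - e' * ((a₀ + t : ℕ) : ℤ) := by
    rw [hn₀1, padicValNat.prime_pow]
    push_cast
    ring
  have hdom : ∀ n : ℕ, n ≠ n₀ → (c : ℤ) * (p : ℤ) ^ (a₀ + t) - e' * ((a₀ + t : ℕ) : ℤ) + 1
      ≤ (c : ℤ) * ((n + 1 : ℕ) : ℤ) - (e' : ℤ) * (padicValNat p (n + 1) : ℤ) := by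
    intro n hn
    obtain ⟨a, ha, ha'⟩ := exists_exponent_le_index (p := p) hc1 e' (Nat.succ_ne_zero n)
    by_cases haa : a = a₀ + t
    · have hne : n + 1 ≠ p ^ a := by
        rw [haa, ← hn₀1]; intro h; exact hn (by omega)
      have := ha' hne
      rw [haa] at this
      exact this
    · exact (hstrict a haa).trans ha
  exact norm_logSeries_eq_zpow_of_dominant p hϖ' hyP hy n₀ hN₀ hdom

/-! ### §3. The depth inequality -/

/-- `‖ϖ‖^N = p^{−N/e}` as real numbers. [cite: NeukirchANT1999, Ch. II (5.5)] -/
theorem norm_unif_zpow_eq_rpow {ϖ : Kˣ} (hϖ : IsUniformizer ϖ) (N : ℤ) :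
    ‖(ϖ : K)‖ ^ N = (p : ℝ) ^ (-(N : ℝ) / (absRamificationIdx p K : ℝ)) := by
  have hp0 : (0 : ℝ) ≤ p := by exact_mod_cast hp.out.pos.le
  rw [norm_eq_rpow_of_isUniformizer p K hϖ, ← Real.rpow_intCast, ← Real.rpow_mul hp0]
  congr 1
  ring

/-- **Depth of the log-unit lattice along a wild ramification jump (tie-free case)**: if
`e(K') = e(K)·c·pᵗ` with `c ≥ 1` and `e(K) ≠ pᵃ(p−1)` for every `a`, then for every `z ∈ log_p(𝒪_K^×)`
there is `z' ∈ log_p(𝒪_{K'}^×)` — namely `z' = log_p(1 − ϖ'ᶜ)` — with **`pᵗ·‖z‖ ≤ ‖z'‖`**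
(`‖z‖ ≤ ‖ϖ‖^{N₀} = p^{−N₀/e}` and `‖z'‖ = ‖ϖ'‖^{c p^{a₀+t} − e'(a₀+t)} = p^{t − N₀/e}`).
[cite: NeukirchANT1999, Ch. II (5.5)] [cite: Mochizuki2012, IUTchIV Prop. 1.2 (i) p. 10] -/
theorem exists_mem_logUnits_pow_mul_norm_le
    (htie : ∀ a : ℕ, absRamificationIdx p K ≠ p ^ a * (p - 1)) {c t : ℕ} (hc : c ≠ 0)
    (he' : absRamificationIdx p K' = absRamificationIdx p K * (c * p ^ t))
    {z : K} (hz : z ∈ logUnits K) :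
    ∃ z' ∈ logUnits K', (p : ℝ) ^ t * ‖z‖ ≤ ‖z'‖ := by
  classical
  obtain ⟨ϖ, hϖ⟩ := exists_isUniformizer (F := K)
  obtain ⟨ϖ', hϖ'⟩ := exists_isUniformizer (F := K')
  set e : ℕ := absRamificationIdx p K with he_def
  set e' : ℕ := absRamificationIdx p K' with he'_def
  have he1 : 1 ≤ e := absRamificationIdx_pos p K
  have hp0 : (0 : ℝ) < p := by exact_mod_cast hp.out.pos
  obtain ⟨a₀, hlo, hhi⟩ := exists_turning p e
  -- tie-free: the turning inequality is strict
  have hhi' : (e : ℤ) < 1 * (p : ℤ) ^ a₀ * ((p : ℤ) - 1) := by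
    refine lt_of_le_of_ne hhi fun heq ↦ htie a₀ ?_
    have h2 : ((p ^ a₀ * (p - 1) : ℕ) : ℤ) = 1 * (p : ℤ) ^ a₀ * ((p : ℤ) - 1) := by
      rw [Nat.cast_mul, Nat.cast_pow, Nat.cast_sub hp.out.one_le]; push_cast; ring
    exact_mod_cast heq.trans h2.symm
  -- the witness `z' = log_p(1 − ϖ'^c)`
  set y : K' := 1 - (ϖ' : K') ^ c with hy_def
  have hyP : IsPrincipal y := by
    rw [isPrincipal_iff, hy_def, sub_sub_cancel, norm_pow]
    exact pow_lt_one₀ (norm_nonneg _) hϖ'.1 hc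
  refine ⟨unitLog y, unitLog_mem_logUnits hyP.norm_eq_one, ?_⟩
  rw [unitLog_of_isPrincipal p hyP, norm_logSeries_one_sub_unif_pow p hϖ' hc he1 he' hlo hhi',
    norm_unif_zpow_eq_rpow p hϖ']
  have hz' := norm_le_zpow_of_mem_logUnits p hϖ hlo hhi hz
  rw [norm_unif_zpow_eq_rpow p hϖ] at hz'
  -- compare the exponents: `t − N₀/e = −(c p^{a₀+t} − e'(a₀+t))/e'`
  have heR : (e : ℝ) ≠ 0 := by exact_mod_cast (absRamificationIdx_pos p K).ne'
  have hcR : (c : ℝ) ≠ 0 := by exact_mod_cast hc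
  have hptR : (p : ℝ) ^ t ≠ 0 := pow_ne_zero _ hp0.ne'
  have he'R : (e' : ℝ) = e * (c * (p : ℝ) ^ t) := by exact_mod_cast he'
  have hexp : (t : ℝ) + -(((1 : ℤ) * (p : ℤ) ^ a₀ - (e : ℤ) * (a₀ : ℤ) : ℤ) : ℝ) / (e : ℝ) =
      -(((c : ℤ) * (p : ℤ) ^ (a₀ + t) - (e' : ℤ) * ((a₀ + t : ℕ) : ℤ) : ℤ) : ℝ) / (e' : ℝ) := by
    push_cast
    rw [he'R]
    field_simp
    ring
  calc (p : ℝ) ^ t * ‖z‖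
      ≤ (p : ℝ) ^ t * (p : ℝ) ^ (-(((1 : ℤ) * (p : ℤ) ^ a₀ - (e : ℤ) * (a₀ : ℤ) : ℤ) : ℝ) / (e : ℝ)) :=
        mul_le_mul_of_nonneg_left hz' (pow_pos hp0 _).le
    _ = (p : ℝ) ^ ((t : ℝ) + -(((1 : ℤ) * (p : ℤ) ^ a₀ - (e : ℤ) * (a₀ : ℤ) : ℤ) : ℝ) / (e : ℝ)) := by
        rw [Real.rpow_add hp0, Real.rpow_natCast]
    _ = (p : ℝ) ^ (-(((c : ℤ) * (p : ℤ) ^ (a₀ + t) - (e' : ℤ) * ((a₀ + t : ℕ) : ℤ) : ℤ) : ℝ) / (e' : ℝ)) := by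
        rw [hexp]

end RamificationCriterion

end Literature.IUT.LogVolume

end
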